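import Literature.NumberTheory.Automorphic.UnitaryGroupAdeleFixedDecomposition
import Literature.NumberTheory.Automorphic.AdelicFundamentalDomain
import Literature.NumberTheory.Automorphic.AdeleQuotientFourier
import HarnessLib

/-!
# The lattice of trace-zero principal adeles `E⁻ ⊂ 𝔸_E⁻` and a fundamental domain for it

Topic `NumberTheory/Automorphic`; namespace `Literature.NumberTheory.Automorphic.UnitaryGroup`.
DEFINITIONS with bodies + proved lemmas; no named fact, no `sorry`, no instance, no notation.
Setting: a quadratic extension `E/F` of number fields with involution `c` (`c * c = 1`), the
trace-zero adeles `𝔸_E⁻ = traceZeroAdele F E c` (`UnitaryGroupGlobalGenericity`) and the projection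
`adeleMinus hc : 𝔸_E → 𝔸_E⁻`, `x ↦ ½(x − c x)` (`UnitaryGroupAdeleFixedDecomposition`).

* `rationalTraceZero F E c ≤ 𝔸_E⁻` — the principal trace-zero adeles `E⁻ = E ∩ 𝔸_E⁻` (the lattice of
  rational points of the centre `Z ≅ 𝔸_E⁻` of the Heisenberg group `N` of `U(3)`, Rogawski (1990),
  §1.10), countable;
* **`traceZeroFundamentalDomain hc`** — the set of `y ∈ 𝔸_E⁻` such that `ξ + y ∈ D_E` for some
  `c`-FIXED `ξ ∈ E`, where `D_E = adeleFundamentalDomain E` is Tate's fundamental domain for `E` in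
  `𝔸_E` (`AdelicFundamentalDomain`); since `E = E⁺ ⊕ E⁻` and every adele has a unique translate by
  `E` in `D_E`, every `y ∈ 𝔸_E⁻` has a UNIQUE translate by `E⁻` in it
  (`existsUnique_vadd_mem_traceZeroFundamentalDomain`), so it is a measurable fundamental domain for
  the translation action of `E⁻` on `𝔸_E⁻` for every measure
  (`isAddFundamentalDomain_traceZeroFundamentalDomain`, Mathlib `IsAddFundamentalDomain.mk'`);
* it is contained in the compact set `adeleMinus '' closure(D_E)` (`y = (ξ + y)⁻`), hence has finite
  measure for every measure finite on compacts (`measure_traceZeroFundamentalDomain_lt_top`), and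
  `E⁻ + adeleMinus '' closure(D_E) = 𝔸_E⁻`.

This is the `𝔸_E⁻`-factor of the fundamental domain of `N(F)` in `N(𝔸_F)` used to compare the
tree's centre-only `CuspCondition` with `BorelCuspCondition` on `U(3)` (Tate, Thm. 4.1.3;
Rogawski (1990), §1.10, §2.1).

## References

* J. Tate, *Fourier analysis in number fields and Hecke's zeta-functions*, in Cassels–Fröhlich
  (1967), Ch. XV, Thm. 4.1.3 [CasselsFrohlichANT1967].
* J. D. Rogawski, *Automorphic Representations of Unitary Groups in Three Variables* (1990), §1.10
  [Rogawski1990].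
-/

noncomputable section

open NumberField IsDedekindDomain Topology MeasureTheory Measure
open scoped Pointwise

namespace Literature.NumberTheory.Automorphic

namespace UnitaryGroup

variable {F E : Type} [Field F] [NumberField F] [Field E] [NumberField E] [Algebra F E]
  {c : E ≃ₐ[F] E}

variable (F E c) in
/-- **The principal trace-zero adeles `E⁻ = E ∩ 𝔸_E⁻`** as an additive subgroup of `𝔸_E⁻` (the
rational points of the centre of the Heisenberg group). [cite: Rogawski1990, §1.10] -/
def rationalTraceZero : AddSubgroup (traceZeroAdele F E c) :=
  (NumberField.AdeleRing.principalSubgroup (𝓞 E) E).comap (traceZeroAdele F E c).subtype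

omit [NumberField F] in
/-- Membership in `E⁻`: the underlying adele is principal. [cite: Rogawski1990, §1.10] -/
theorem mem_rationalTraceZero_iff (y : traceZeroAdele F E c) :
    y ∈ rationalTraceZero F E c ↔ ∃ ξ : E, algebraMap E (AdeleRing (𝓞 E) E) ξ = y := by
  change (y : AdeleRing (𝓞 E) E) ∈ NumberField.AdeleRing.principalSubgroup (𝓞 E) E ↔ _
  constructor
  · rintro ⟨ξ, hξ⟩; exact ⟨ξ, hξ⟩
  · rintro ⟨ξ, hξ⟩; exact ⟨ξ, hξ⟩

omit [NumberField F] in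
/-- `E⁻` is countable. [cite: Rogawski1990, §1.10] -/
theorem countable_rationalTraceZero : Countable (rationalTraceZero F E c) := by
  have h : Function.Injective fun y : rationalTraceZero F E c =>
      (⟨((y : traceZeroAdele F E c) : AdeleRing (𝓞 E) E), y.2⟩ :
        NumberField.AdeleRing.principalSubgroup (𝓞 E) E) := by
    intro a b hab
    have := congrArg (fun z : NumberField.AdeleRing.principalSubgroup (𝓞 E) E => (z : AdeleRing (𝓞 E) E)) hab
    exact Subtype.ext (Subtype.ext this)
  exact Function.Injective.countable h

/-- The `c`-fixed part `½(ξ + c ξ)` and the trace-zero part `½(ξ − c ξ)` of `ξ ∈ E`. [folklore] -/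
private def ratPlus (ξ : E) : E := 2⁻¹ * (ξ + c ξ)

/-- The trace-zero part `½(ξ − c ξ)` of `ξ ∈ E`. [folklore] -/
private def ratMinus (ξ : E) : E := 2⁻¹ * (ξ - c ξ)

omit [NumberField F] in
/-- `ξ = ξ⁺ + ξ⁻`. [folklore] -/
private theorem ratPlus_add_ratMinus (ξ : E) : ratPlus (c := c) ξ + ratMinus (c := c) ξ = ξ := by
  simp only [ratPlus, ratMinus]; ring

omit [NumberField F] in
/-- `ξ⁺` is `c`-fixed when `c² = 1`. [folklore] -/
private theorem c_ratPlus (hc : c * c = 1) (ξ : E) : c (ratPlus (c := c) ξ) = ratPlus (c := c) ξ := by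
  have hcc : c (c ξ) = ξ := by rw [← AlgEquiv.mul_apply, hc, AlgEquiv.one_apply]
  simp only [ratPlus, map_mul, map_add, map_inv₀, map_ofNat, hcc]; ring

omit [NumberField F] in
/-- `ξ⁻` is `c`-antifixed when `c² = 1`. [folklore] -/
private theorem c_ratMinus (hc : c * c = 1) (ξ : E) : c (ratMinus (c := c) ξ) = -ratMinus (c := c) ξ := by
  have hcc : c (c ξ) = ξ := by rw [← AlgEquiv.mul_apply, hc, AlgEquiv.one_apply]
  simp only [ratMinus, map_mul, map_sub, map_inv₀, map_ofNat, hcc]; ring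

omit [NumberField F] in
/-- A `c`-antifixed element is its own trace-zero part. [folklore] -/
private theorem ratMinus_eq_self_of_c_eq_neg {η : E} (h : c η = -η) : ratMinus (c := c) η = η := by
  simp only [ratMinus, h]; ring

omit [NumberField F] [NumberField E] in
/-- A `c`-fixed element has zero trace-zero part. [folklore] -/
private theorem ratMinus_eq_zero_of_c_eq {ξ : E} (h : c ξ = ξ) : ratMinus (c := c) ξ = 0 := by
  simp only [ratMinus, h, sub_self, mul_zero]

omit [NumberField F] in
/-- `(ξ + η)⁻ = ξ⁻ + η⁻`. [folklore] -/
private theorem ratMinus_add (ξ η : E) : ratMinus (c := c) (ξ + η) = ratMinus (c := c) ξ + ratMinus (c := c) η := by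
  simp only [ratMinus, map_add]; ring

/-- The principal trace-zero adele of `η ∈ E` with `c η = -η`, as an element of `E⁻`. [folklore] -/
private def ratElt {η : E} (h : c η = -η) : rationalTraceZero F E c :=
  ⟨⟨algebraMap E (AdeleRing (𝓞 E) E) η, algebraMap_mem_traceZeroAdele h⟩, η, rfl⟩

/-- **The fundamental domain `𝓕⁻` for `E⁻` in `𝔸_E⁻`**: the trace-zero adeles `y` with `ξ + y ∈ D_E`
for some `c`-fixed `ξ ∈ E` (`D_E` Tate's fundamental domain for `E` in `𝔸_E`).
[cite: CasselsFrohlichANT1967, Ch. XV Thm. 4.1.3 (1)] -/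
def traceZeroFundamentalDomain (F E : Type) [Field F] [Field E] [NumberField E] [Algebra F E]
    (c : E ≃ₐ[F] E) : Set (traceZeroAdele F E c) :=
  {y | ∃ ξ : E, c ξ = ξ ∧ algebraMap E (AdeleRing (𝓞 E) E) ξ + (y : AdeleRing (𝓞 E) E) ∈ adeleFundamentalDomain E}

omit [NumberField F] in
/-- Membership in `𝓕⁻` (definitional). [cite: CasselsFrohlichANT1967, Ch. XV Thm. 4.1.3 (1)] -/
theorem mem_traceZeroFundamentalDomain_iff (y : traceZeroAdele F E c) :
    y ∈ traceZeroFundamentalDomain F E c ↔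
      ∃ ξ : E, c ξ = ξ ∧ algebraMap E (AdeleRing (𝓞 E) E) ξ + (y : AdeleRing (𝓞 E) E) ∈ adeleFundamentalDomain E :=
  Iff.rfl

omit [NumberField F] in
/-- **Every `y ∈ 𝔸_E⁻` has exactly one translate by `E⁻` in `𝓕⁻`** (Tate's unique representability
modulo `E`, `existsUnique_add_algebraMap_mem_adeleFundamentalDomain`, split along `E = E⁺ ⊕ E⁻`).
[cite: CasselsFrohlichANT1967, Ch. XV Thm. 4.1.3 (1)] -/
theorem existsUnique_vadd_mem_traceZeroFundamentalDomain (hc : c * c = 1) (y : traceZeroAdele F E c) :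
    ∃! g : rationalTraceZero F E c, g +ᵥ y ∈ traceZeroFundamentalDomain F E c := by
  haveI : Nontrivial (AdeleRing (𝓞 E) E) :=
    inferInstanceAs (Nontrivial (InfiniteAdeleRing E × FiniteAdeleRing (𝓞 E) E))
  obtain ⟨ξ, hξ, huniq⟩ := existsUnique_add_algebraMap_mem_adeleFundamentalDomain E (y : AdeleRing (𝓞 E) E)
  refine ⟨ratElt (c_ratMinus hc ξ), ?_, ?_⟩
  · -- `ξ⁻ + y ∈ 𝓕⁻` with witness `ξ⁺`
    refine ⟨ratPlus (c := c) ξ, c_ratPlus hc ξ, ?_⟩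
    change algebraMap E (AdeleRing (𝓞 E) E) (ratPlus (c := c) ξ) +
      (algebraMap E (AdeleRing (𝓞 E) E) (ratMinus (c := c) ξ) + (y : AdeleRing (𝓞 E) E)) ∈ adeleFundamentalDomain E
    rw [← add_assoc, ← map_add, ratPlus_add_ratMinus]
    exact hξ
  · -- uniqueness: `η + ξ'⁺ = ξ` forces `η = ξ⁻`
    rintro ⟨⟨g, hg⟩, η, hη⟩ ⟨ξ', hξ'c, hmem⟩
    change algebraMap E (AdeleRing (𝓞 E) E) ξ' + (g + (y : AdeleRing (𝓞 E) E)) ∈ adeleFundamentalDomain E at hmem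
    change algebraMap E (AdeleRing (𝓞 E) E) η = g at hη
    rw [← hη, ← add_assoc, ← map_add] at hmem
    have hsum : ξ' + η = ξ := huniq _ hmem
    have hηc : c η = -η := by
      have hg' := (mem_traceZeroAdele_iff _).1 hg
      rw [← hη, ← algebraMap_conj, RingHom.coe_coe, ← map_neg] at hg'
      exact (algebraMap E (AdeleRing (𝓞 E) E)).injective hg'
    have hη' : η = ratMinus (c := c) ξ := by
      rw [← hsum, ratMinus_add, ratMinus_eq_zero_of_c_eq hξ'c, zero_add, ratMinus_eq_self_of_c_eq_neg hηc]
    refine Subtype.ext (Subtype.ext ?_)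
    change g = algebraMap E (AdeleRing (𝓞 E) E) (ratMinus (c := c) ξ)
    rw [← hη, hη']

omit [NumberField F] in
/-- **`𝓕⁻ ⊆ (closure D_E)⁻`**: for `y ∈ 𝓕⁻` with witness `ξ`, `y = ½((ξ + y) − c(ξ + y))` is the trace-zero
part of a point of `D_E`. [cite: CasselsFrohlichANT1967, Ch. XV Cor. 4.1.1] -/
theorem traceZeroFundamentalDomain_subset_image (hc : c * c = 1) :
    traceZeroFundamentalDomain F E c ⊆ adeleMinus hc '' closure (adeleFundamentalDomain E) := by
  rintro y ⟨ξ, hξc, hmem⟩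
  refine ⟨_, subset_closure hmem, Subtype.ext ?_⟩
  have hy := (mem_traceZeroAdele_iff _).1 y.2
  have h2 : (halfAdele : AdeleRing (𝓞 E) E) + halfAdele = 1 := by
    rw [halfAdele, ← map_add, ← map_one (algebraMap E (AdeleRing (𝓞 E) E))]
    congr 1; norm_num
  rw [coe_adeleMinus, map_add, ← algebraMap_conj, RingHom.coe_coe, hξc, hy]
  linear_combination (y : AdeleRing (𝓞 E) E) * h2

omit [NumberField F] in
/-- `𝓕⁻` is contained in a compact set. [cite: CasselsFrohlichANT1967, Ch. XV Cor. 4.1.1] -/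
theorem exists_isCompact_traceZeroFundamentalDomain_subset (hc : c * c = 1) :
    ∃ K : Set (traceZeroAdele F E c), IsCompact K ∧ traceZeroFundamentalDomain F E c ⊆ K :=
  ⟨_, (isCompact_closure_adeleFundamentalDomain E).image
    ((continuous_const.mul (continuous_id.sub (continuous_conjAdele F E c))).subtype_mk _),
    traceZeroFundamentalDomain_subset_image hc⟩

omit [NumberField F] in
/-- **`E⁻ + K = 𝔸_E⁻` for the compact `K = (closure D_E)⁻`**: every trace-zero adele is a rational
trace-zero translate of a point of `K`. [cite: CasselsFrohlichANT1967, Ch. XV Thm. 4.1.3 (1)] -/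
theorem exists_rationalTraceZero_vadd_mem_image (hc : c * c = 1) (y : traceZeroAdele F E c) :
    ∃ g : rationalTraceZero F E c, g +ᵥ y ∈ adeleMinus hc '' closure (adeleFundamentalDomain E) := by
  obtain ⟨g, hg, -⟩ := existsUnique_vadd_mem_traceZeroFundamentalDomain hc y
  exact ⟨g, traceZeroFundamentalDomain_subset_image hc hg⟩

section Measure

variable [MeasurableSpace (AdeleRing (𝓞 E) E)] [BorelSpace (AdeleRing (𝓞 E) E)]

omit [NumberField F] in
/-- `𝓕⁻` is a Borel set (a countable union over the principal adeles of translates of the Borel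
set `D_E`). [cite: CasselsFrohlichANT1967, Ch. XV Thm. 4.1.3 (1)] -/
theorem measurableSet_traceZeroFundamentalDomain : MeasurableSet (traceZeroFundamentalDomain F E c) := by
  have e : traceZeroFundamentalDomain F E c =
      ⋃ a : {a : NumberField.AdeleRing.principalSubgroup (𝓞 E) E // conjAdele F E c a = a},
        {y : traceZeroAdele F E c | ((a : NumberField.AdeleRing.principalSubgroup (𝓞 E) E) : AdeleRing (𝓞 E) E) +
          (y : AdeleRing (𝓞 E) E) ∈ adeleFundamentalDomain E} := by
    ext y
    simp only [Set.mem_iUnion, Set.mem_setOf_eq, mem_traceZeroFundamentalDomain_iff]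
    constructor
    · rintro ⟨ξ, hξc, hmem⟩
      refine ⟨⟨⟨algebraMap E _ ξ, ξ, rfl⟩, ?_⟩, hmem⟩
      change conjAdele F E c (algebraMap E (AdeleRing (𝓞 E) E) ξ) = algebraMap E (AdeleRing (𝓞 E) E) ξ
      rw [← algebraMap_conj, RingHom.coe_coe, hξc]
    · rintro ⟨⟨⟨a, ξ, rfl⟩, ha⟩, hmem⟩
      haveI : Nontrivial (AdeleRing (𝓞 E) E) :=
        inferInstanceAs (Nontrivial (InfiniteAdeleRing E × FiniteAdeleRing (𝓞 E) E))
      refine ⟨ξ, ?_, hmem⟩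
      change conjAdele F E c (algebraMap E (AdeleRing (𝓞 E) E) ξ) = algebraMap E (AdeleRing (𝓞 E) E) ξ at ha
      rw [← algebraMap_conj, RingHom.coe_coe] at ha
      exact (algebraMap E (AdeleRing (𝓞 E) E)).injective ha
  rw [e]
  haveI : Countable (NumberField.AdeleRing.principalSubgroup (𝓞 E) E) := countable_principalSubgroup E
  refine MeasurableSet.iUnion fun a => ?_
  exact (measurableSet_adeleFundamentalDomain E).preimage
    ((continuous_const.add continuous_subtype_val).measurable)

omit [NumberField F] in
/-- **`𝓕⁻` is a measurable fundamental domain for the translation action of `E⁻` on `𝔸_E⁻`**, for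
every measure on `𝔸_E⁻` (Mathlib `IsAddFundamentalDomain.mk'` from unique representability).
[cite: CasselsFrohlichANT1967, Ch. XV Thm. 4.1.3 (1)] -/
theorem isAddFundamentalDomain_traceZeroFundamentalDomain (hc : c * c = 1) (μ : Measure (traceZeroAdele F E c)) :
    IsAddFundamentalDomain (rationalTraceZero F E c) (traceZeroFundamentalDomain F E c) μ :=
  IsAddFundamentalDomain.mk' measurableSet_traceZeroFundamentalDomain.nullMeasurableSet
    (existsUnique_vadd_mem_traceZeroFundamentalDomain hc)

omit [NumberField F] [BorelSpace (AdeleRing (𝓞 E) E)] in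
/-- `𝓕⁻` has finite measure for every measure finite on compact sets.
[cite: CasselsFrohlichANT1967, Ch. XV Thm. 4.1.3 (2)] -/
theorem measure_traceZeroFundamentalDomain_lt_top (hc : c * c = 1) (μ : Measure (traceZeroAdele F E c))
    [IsFiniteMeasureOnCompacts μ] : μ (traceZeroFundamentalDomain F E c) < ⊤ := by
  obtain ⟨K, hK, hsub⟩ := exists_isCompact_traceZeroFundamentalDomain_subset (F := F) (E := E) (c := c) hc
  exact (measure_mono hsub).trans_lt hK.measure_lt_top

end Measure

end UnitaryGroup

end Literature.NumberTheory.Automorphic
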